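import Summits.BirchSwinnertonDyer.BirchSwinnertonDyer.Theorems.KolyvaginDepthDoorDepthTableSteinWuthrichRankThree5077a1Exact
import Summits.BirchSwinnertonDyer.BirchSwinnertonDyer.Theorems.KolyvaginDepthDoorDepthTableSteinWuthrichOddRankLValue
import HarnessLib

/-!
# Route `KolyvaginDepthDoor`, crux `KolyvaginDepthSupplyKN` (stmt-BirchSwinnertonDyer-22820) —
# DEPTH TABLE v14: the crux at Gross–Zagier's curve `5077a1` from ONE `L`-VALUE VALUATION AT ANY ADMISSIBLE PRIME

Helper file of the lead prover of line `levelone` (kdd-p1 g18; `--supports stmt-BirchSwinnertonDyer-22820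
--as helper`); it closes nothing and BSD is NOT proved by it.

`…RankThree5077a1Exact` closes the crux at `5077a1` modulo «`L(T,1) ≠ 0` ∧ `ord_5(L(T,1)/Ω_T) ≤ 0`» for Gross–Zagier's twist
`T = E^{(−7)}` (minimal model `T₀ = [0,0,1,−343,−2144]`) at the prime `p = 5`, and separately gives the clause from one twist
Selmer bound at ANY admissible prime (`cruxBody_of_twistSelmer_at`). The algebraic part `L(T,1)/Ω_T` is ONE fixed non-zero
rational (if `L(T,1) ≠ 0`), so it is a `p`-adic unit at all but finitely many `p`; this file therefore moves the `L`-value reading to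
an ARBITRARY admissible prime: `p`-uniform side conditions of `T₀` (`kodairaNeron_twist7_of_five_le`: `Δ_T = 7⁶·5077`, exponents
`6, 1` prime to every `p ≥ 5`; the multiplicative prime `5077` with `v = 1`; `T[p]` irreducible from `ρ̄_{E,p}` onto), the generic
`natCard_selmerGroup_eq_one_of_rankZero_LValue` (Skinner 2016 Thm. C + GZK by name) and `cruxBody_of_twistSelmer_at`:

* `C5077a1.cruxBody_of_twistLValue_at` — for every prime `5 ≤ p < 1000`, `p ≠ 7`, good ordinary for `E` AND for `T` with
  `ρ_{E,p^n}` onto (hypotheses; kernel-certified at `p = 5`), and any `K` with `d_K = −7`: IF `L(T,1) ≠ 0` and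
  `ord_p(L(T,1)/Ω_T) ≤ 0` THEN the clause of `KolyvaginDepthSupplyKN` holds at `5077a1` verbatim — modulo SW Thm. 1.1, W. Zhang
  L8.4 (1) / 9.1, Skinner 2016 Thm. C and GZK by name. The kit may take the ONE rational `L(T,1)/Ω_T` and ANY admissible prime not
  dividing it.

Per curve; nothing class-wide (the open stub (S♭) is untouched); BSD is NOT proved by any of this.

References: [Skinner2016PacificMC] Thm. C (p. 173); [Darmon2004] Thm. 3.22; [SteinWuthrich2013] Thm. 1.1; [WZhang2014] Lemma 8.4
(1), Thm. 9.1; [GrossZagier1986] §V.4; [CremonaAlgorithms1997] Table 1 (5077a1).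
-/

set_option linter.dupNamespace false

noncomputable section

open scoped Classical NumberField

namespace Summit.BirchSwinnertonDyer.BirchSwinnertonDyer.Theorems.KolyvaginDepthDoor

open Literature.NumberTheory.EllipticCurves Literature.NumberTheory.EllipticCurves.ModularForms
  WeierstrassCurve NumberField IsDedekindDomain
open Summit.BirchSwinnertonDyer.BirchSwinnertonDyer.Theorems
open Summit.BirchSwinnertonDyer.BirchSwinnertonDyer.Rank2Observatory
open Summit.BirchSwinnertonDyer.BirchSwinnertonDyer.Rank1Residual
open Summit.BirchSwinnertonDyer.Rank1Residual.Additive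

namespace C5077a1

/-- **Kodaira–Néron for the twist `T₀ = [0,0,1,−343,−2144]` at every prime `p ≥ 5`**: `Δ_T = 7⁶·5077`, so `ord_v(Δ_T) ∈ {6, 1}`
at the bad places and `p ∤ ord_v(Δ_T)` at every multiplicative `v` (the table lemma with `B = 58`, `58⁵ ≤ 58^p`; the prime `7 < 58`
carries the exponent `6`, prime to every `p ≥ 5`). [cite: SilvermanAEC2009, VII.5.1, VIII.8] -/
theorem kodairaNeron_twist7_of_five_le (p : ℕ) [hp : Fact p.Prime] (h5 : 5 ≤ p) :
    haveI := isElliptic_twist7; haveI := isGloballyMinimal_twist7;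
    ∀ v : HeightOneSpectrum (𝓞 ℚ),
      ((⟨0, 0, 1, -343, -2144⟩ : WeierstrassCurve ℤ).map (Int.castRingHom ℚ)).HasMultiplicativeReductionAt v →
      ¬ p ∣ ((⟨0, 0, 1, -343, -2144⟩ : WeierstrassCurve ℤ).map (Int.castRingHom ℚ)).ordMinimalDiscriminant v := by
  haveI := isElliptic_twist7
  haveI := isGloballyMinimal_twist7
  refine not_dvd_ordMinimalDiscriminant_of_intModel_table intModel_twist7 (p := p) (Δ₀ := 597303973) (by decide +kernel)
    (B := 58) (lt_of_lt_of_le (by norm_num) (Nat.pow_le_pow_right (by norm_num) h5)) ?_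
  intro q hq hqP hqd
  have hn : ((597303973 : ℤ).natAbs) = 7 ^ 6 * 5077 := by norm_num
  rw [hn] at hqd ⊢
  rcases (Nat.Prime.dvd_mul hqP).mp hqd with h | h
  · obtain rfl := (Nat.prime_dvd_prime_iff_eq hqP (by norm_num)).mp (hqP.dvd_of_dvd_pow h)
    refine ⟨6, by simp, by decide, by decide, fun h6 ↦ ?_⟩
    have hp6 : p ≤ 6 := Nat.le_of_dvd (by norm_num) h6
    interval_cases p <;> simp_all (config := {decide := true})
  · obtain rfl := (Nat.prime_dvd_prime_iff_eq hqP (by norm_num)).mp h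
    exact absurd (Finset.mem_range.mp hq) (by norm_num)

/-- **THE CRUX AT `5077a1` FROM ONE `L`-VALUE VALUATION AT ANY ADMISSIBLE PRIME** (Stein–Wuthrich, W. Zhang, Skinner 2016 Thm. C, GZK
by name). For every prime `5 ≤ p < 1000`, `p ≠ 7`, of good ordinary reduction for `E = 5077a1` with `ρ_{E,p^n}` onto for all `n`,
and of good ordinary reduction for Gross–Zagier's twist `T` (model `T₀ = [0,0,1,−343,−2144]`), and ANY imaginary quadratic `K` with
`d_K = −7`: IF `L(T,1) ≠ 0` and `ord_p(L(T,1)/Ω_T) ≤ 0` THEN the CLAUSE of the crux holds at `5077a1` VERBATIM. Chain: `T[p]`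
irreducible (twist of the onto `ρ̄_{E,p}`, `twist_smul_eq`); Skinner + GZK (`natCard_selmerGroup_eq_one_of_rankZero_LValue`, with the
multiplicative prime `5077`, `v = 1`, and `kodairaNeron_twist7_of_five_le`): `#Sel_p(T) = 1`; transport to `E.quadraticTwist (−7)`;
`cruxBody_of_twistSelmer_at`. Since `L(T,1)/Ω_T` is ONE rational, all but finitely many admissible `p` qualify once `L(T,1) ≠ 0`.
CONDITIONAL on the four named facts and the hypotheses on `p`; per curve; BSD is not proved by it. [cite: Skinner2016PacificMC, Thm. C (p. 173)]
[cite: Darmon2004, Thm. 3.22] [cite: SteinWuthrich2013, Thm. 1.1 (p. 1758)] [cite: WZhang2014, Lemma 8.4 (1) (p. 236), Thm. 9.1 (p. 240)] -/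
theorem cruxBody_of_twistLValue_at
    (hSW : SteinWuthrich2013_sha_inf_torsionBy_eq_bot_of_two_le_rank)
    (h84 : Literature.NumberTheory.EllipticCurves.WZhang2014_lemma84_exists_minimal_kolyvaginClass_one_selmerCard)
    (hSk : Skinner2016_padicValRat_bsd_rank_zero) (hGZK : rank_eq_analyticRank_of_analyticRank_le_one)
    (p : ℕ) [hp : Fact p.Prime] (h5 : 5 ≤ p) (hp1000 : p < 1000) (hp7 : p ≠ 7)
    (hgood : haveI := isGloballyMinimal_of_mem_atlasR3A00 mem_atlas; (c5077a1.e.baseChange ℚ).HasGoodReductionAtPrime p)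
    (hord : haveI := isGloballyMinimal_of_mem_atlasR3A00 mem_atlas; ¬ (p : ℤ) ∣ (c5077a1.e.baseChange ℚ).frobeniusTrace p)
    (htower : ∀ n : ℕ, (c5077a1.e.baseChange ℚ).HasSurjectiveModNGaloisRep (p ^ n : ℕ))
    (hgoodT : haveI := isGloballyMinimal_twist7;
      ((⟨0, 0, 1, -343, -2144⟩ : WeierstrassCurve ℤ).map (Int.castRingHom ℚ)).HasGoodReductionAtPrime p ∧
        ¬ (p : ℤ) ∣ ((⟨0, 0, 1, -343, -2144⟩ : WeierstrassCurve ℤ).map (Int.castRingHom ℚ)).frobeniusTrace p)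
    (K : Type) [Field K] [NumberField K] (hK : IsImaginaryQuadratic K) (hD : NumberField.discr K = -7)
    (hL : haveI := isElliptic_twist7;
      ((⟨0, 0, 1, -343, -2144⟩ : WeierstrassCurve ℤ).map (Int.castRingHom ℚ)).entireLFunction 1 ≠ 0)
    (hval : haveI := isElliptic_twist7; haveI := isGloballyMinimal_twist7;
      ∀ q : ℚ, ((⟨0, 0, 1, -343, -2144⟩ : WeierstrassCurve ℤ).map (Int.castRingHom ℚ)).entireLFunction 1 /
          ((((⟨0, 0, 1, -343, -2144⟩ : WeierstrassCurve ℤ).map (Int.castRingHom ℚ)).realPeriodRat : ℝ) : ℂ) = (q : ℂ) →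
        padicValRat p q ≤ 0) :
    haveI := isElliptic_of_mem_atlasR3A00 mem_atlas;
    haveI := isGloballyMinimal_of_mem_atlasR3A00 mem_atlas;
    ∃ (p : ℕ) (hp : Fact p.Prime), 5 ≤ p ∧ (c5077a1.e.baseChange ℚ).HasGoodReductionAtPrime p ∧
      ¬ (p : ℤ) ∣ (c5077a1.e.baseChange ℚ).frobeniusTrace p ∧
      (∀ n : ℕ, (c5077a1.e.baseChange ℚ).HasSurjectiveModNGaloisRep (p ^ n : ℕ)) ∧
      (∀ v : HeightOneSpectrum (𝓞 ℚ), (c5077a1.e.baseChange ℚ).HasMultiplicativeReductionAt v →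
        ¬ p ∣ (c5077a1.e.baseChange ℚ).ordMinimalDiscriminant v) ∧
      ∃ (K : Type) (_ : Field K) (_ : NumberField K), IsImaginaryQuadratic K ∧
        NumberField.discr K ≠ -3 ∧ NumberField.discr K ≠ -4 ∧
        ∃ (_ : NeZero ((c5077a1.e.baseChange ℚ).conductorNorm ℤ)),
          SatisfiesHeegnerHypothesis ((c5077a1.e.baseChange ℚ).conductorNorm ℤ) K ∧
        ∃ (Dt : ModularParametrizationData (c5077a1.e.baseChange ℚ) ((c5077a1.e.baseChange ℚ).conductorNorm ℤ))
          (β : ℤ) (ι : K →+* ℂ) (n₁ : ℕ) (d : KolyvaginHeegnerData Dt β ι n₁), Squarefree n₁ ∧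
          (∀ q ∈ n₁.primeFactors,
            Zhang2014.IsKolyvaginPrime ((c5077a1.e.baseChange ℚ).conductorNorm ℤ) (c5077a1.e.baseChange ℚ) K p q) ∧
          d.kolyvaginClass hp.out 1 ≠ 0 ∧
          (n₁.primeFactors.card + 1 ≤ (c5077a1.e.baseChange ℚ).mordellWeilRank ∨
            (n₁.primeFactors.card ≤ (c5077a1.e.baseChange ℚ).mordellWeilRank ∧
              n₁.primeFactors.card + 1 ≤
                ((c5077a1.e.baseChange ℚ).quadraticTwist (NumberField.discr K : ℚ)).mordellWeilRank)) := by
  haveI := isElliptic_of_mem_atlasR3A00 mem_atlas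
  haveI := isGloballyMinimal_of_mem_atlasR3A00 mem_atlas
  haveI := isElliptic_twist7
  haveI := isGloballyMinimal_twist7
  set T := (⟨0, 0, 1, -343, -2144⟩ : WeierstrassCurve ℤ).map (Int.castRingHom ℚ) with hT
  -- `T[p]` irreducible, from `ρ̄_{E,p}` onto
  have hsur : (c5077a1.e.baseChange ℚ).HasSurjectiveModNGaloisRep p := by simpa only [pow_one] using htower 1
  have hirr : (c5077a1.e.baseChange ℚ).HasIrreducibleModPGaloisRep p :=
    hasIrreducibleModPGaloisRep_of_hasSurjectiveModNGaloisRep _ p hsur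
  have hirrT : T.HasIrreducibleModPGaloisRep p :=
    ((c5077a1.e.baseChange ℚ).hasIrreducibleModPGaloisRep_iff_of_smul_eq_quadraticTwist _
      (by norm_num : (-7 : ℚ) ≠ 0) twist_smul_eq p).mpr hirr
  -- the ramified multiplicative prime `5077` (`p ≠ 5077` as `p < 1000`)
  haveI i5077 := Fact.mk (by norm_num : Nat.Prime 5077)
  have hram : ∃ q : ℕ, ∃ _ : Fact q.Prime, q ≠ p ∧ T.HasMultiplicativeReductionAtPrime q ∧
      ¬ p ∣ padicValInt q T.minimalDiscriminantInt := by
    refine ⟨5077, i5077, by omega, hasMultiplicativeReductionAtPrime_5077_twist7.1, ?_⟩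
    rw [hasMultiplicativeReductionAtPrime_5077_twist7.2]
    exact fun h ↦ hp.out.one_lt.ne' (Nat.dvd_one.mp h)
  have hSelT : Nat.card (T.selmerGroup p) = 1 :=
    natCard_selmerGroup_eq_one_of_rankZero_LValue hSk hGZK T p h5 (Or.inl hgoodT) hirrT hram
      (kodairaNeron_twist7_of_five_le p h5) hL hval
  have hSel : Nat.card (((c5077a1.e.baseChange ℚ).quadraticTwist (-7 : ℚ)).selmerGroup p) = 1 := by
    rw [← natCard_selmerGroup_eq_of_variableChange (p : ℤ) twist_smul_eq]; exact hSelT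
  refine cruxBody_of_twistSelmer_at hSW h84 p h5 hp1000 hp7 hgood hord htower K hK hD ?_
  have hcast : (NumberField.discr K : ℚ) = (-7 : ℚ) := by rw [hD]; norm_num
  rw [hcast, hSel]
  exact Nat.one_le_pow _ _ hp.out.pos

end C5077a1

end Summit.BirchSwinnertonDyer.BirchSwinnertonDyer.Theorems.KolyvaginDepthDoor

end
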